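import Literature.AlgebraicGeometry.Motives.CubicFormAlongLine
import HarnessLib

/-!
# Cubic surfaces `X ∩ P₀` with `P₀` tangent to `X` along a line are line-swept (Mboro, Prop. 1.4)

R. Mboro, *Remarks on the `CH₂` of cubic hypersurfaces* (arXiv:1701.04488), proof of Prop. 1.4
(p. 8): "we can choose a `P₀ ≃ ℙ³ ⊂ ℙⁿ⁺¹` tangent to `X` along `l₀`. Then `S := P₀ ∩ X` is a cubic
surface singular along `l₀` which is ruled by lines of `X`. Indeed, for any `x ∈ S ∖ l₀`,
`span(x, l₀) ∩ S` is a plane cubic containing `l₀` with multiplicity `2`; so that the residual curve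
is a line passing through `x`. So, we can write `S = q(p⁻¹(D))` …, `H_X^{n-2} = [S] = P_*([D])`."
This file proves the ruling statement in the tree's rendering of `Im(P_*)` by LINE-SWEPT points
(`ProjFamily.IsLineSweptPoint`, `Motives/LineSweptSurfaces`), for ANY line `l₀ ⊆ X` and any
`3`-plane `M ⊇ l₀` tangent to `X` along `l₀` and not contained in `X`:

* `ProjFamily.isLineSweptPoint_of_mem_tangentCubicSection` — **every surface point `η ∈ X` lying
  on `S = X ∩ M` (`L ∈ 𝔭_η` for the equations `L` of `M`) is line-swept.** Cases: `η` is (the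
  generic point of) a plane of `M` through which `S` passes (`IsLinearSubspacePoint.isLineSweptPoint`);
  `η` lies on the quadric cone `V₊(F'_a) ∩ M` of the polar form of `F` at a point `a ∈ l₀`
  (`isLineSweptPoint_of_mem_quadricSurface`, `Motives/LineSweptQuadricSurfaces`, transferred from
  `ℙᵈ⁺¹` to `X` by `IsLineSweptPoint.of_base`); otherwise `η` is the specialisation of the
  residual line `l_τ` of `span(l₀, z_τ) ∩ S` over the abstract curve of `Motives/LineSweptPlanes`
  (`F|_{span(l₀, z)} = γ² (α F'_a(z) + β F'_b(z) + γ F(z))` by `Motives/CubicFormAlongLine`; a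
  form vanishing on `l_τ` vanishes on every residual line, hence on `S` off two surfaces, and
  Hilbert's Nullstellensatz puts it in `𝔭_η`).

The consumer is `Motives/CubicHyperplaneClassLineSweptFive` (`H_X^{d-2} ∈ ⟨line-swept⟩` and
`CH₂(X) = ⟨line-swept⟩` for smooth cubics of dimension `d ≥ 5`, Mboro's range).
Everything is proved; no named facts.

## References

* [Mboro2018] R. Mboro, Remarks on the CH₂ of cubic hypersurfaces, arXiv:1701.04488, proof of
  Prop. 1.4 (p. 8), Lemma 1.1 (p. 6).
* [Hartshorne1977] R. Hartshorne, Algebraic Geometry (1977), I Thm. 1.3A (Nullstellensatz),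
  I Ex. 2.11.
-/

noncomputable section

open CategoryTheory CategoryTheory.Limits AlgebraicGeometry MonoidalCategory MvPolynomial
  TopologicalSpace Order Topology Matrix
open Literature.AlgebraicGeometry.Motives.Segre Literature.AlgebraicGeometry.Motives.RatFn
open Literature.FieldTheory.QuasiAlgClosed (IsCrSystem.eval_map_algebraMap)

universe u

namespace Literature.AlgebraicGeometry.Motives

attribute [local instance] MvPolynomial.gradedAlgebra MvPolynomial.algebraMvPolynomial
  Literature.AlgebraicGeometry.Motives.ProjBaseChange.algebraBase
  UniversalHyperplaneSection.sectionsAlgebra ProjFamily.functionFieldAlgebra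

namespace ProjFamily

open ProjBaseChangeRing ProjectiveSpaceCells ProjectiveSpace ProjSpace
  Literature.RingTheory.MvPolynomial

/-! ### Transfer of line-sweptness from `ℙᵈ⁺¹` to `X` -/

section Transfer

variable {k : Type u} [Field k] {d : ℕ} {X : SchemeOver k} {i : X ⟶ projectiveSpace (d + 1) k}
  [IsClosedImmersion i.left]

/-- **A point of `X` whose image is line-swept in `ℙᵈ⁺¹` is line-swept in `X`**: the `K`-line of
`ℙᵈ⁺¹_K` sweeping out `closure {i η}` specialises to a point of `X`, hence is a `K`-line of the
generic fibre `X_K` (`exists_point_of_fibre_line`). [folklore] -/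
theorem IsLineSweptPoint.of_base {η : ↥X.left} (hη2 : height η = 2)
    (h : IsLineSweptPoint (𝟙 (projectiveSpace (d + 1) k)) (i.left.base η)) : IsLineSweptPoint i η := by
  obtain ⟨-, B, _, _, hB1, htr, hpid, x', hx'line, hfst⟩ := h
  obtain ⟨-, L', hL'li, hL'hom, hcl⟩ := hx'line
  have ht : d + 1 - 1 ≤ d + 1 := Nat.sub_le _ _
  have hid : ∀ S : Set ↥(projectiveSpace (d + 1) B.left.functionField).left,
      ⇑(CommaMorphism.left (𝟙 (projectiveSpace (d + 1) B.left.functionField))).base '' S = S := by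
    intro S
    ext q
    constructor
    · rintro ⟨q', hq', rfl⟩; exact hq'
    · intro hq; exact ⟨q, hq, rfl⟩
  -- the `K`-line point `iK x'` is the generic point of `V₊(L')`
  have hpeq : (iK (d + 1) B (projectiveSpace (d + 1) k) (𝟙 (projectiveSpace (d + 1) k))).base x' =
      linearSubspacePoint L' hL'li hL'hom ht := by
    refine eq_linearSubspacePoint_of_closure_eq L' hL'li hL'hom ht ?_
    rw [← hcl, hid]
  -- its specialisation is `i η`
  have hproj : projMap (d := d + 1) k B.left.functionField (linearSubspacePoint L' hL'li hL'hom ht) =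
      i.left.base η := by
    refine (fst_genericFibreι_apply (d + 1) B (linearSubspacePoint L' hL'li hL'hom ht)).symm.trans ?_
    rw [← hpeq]
    change ((iK (d + 1) B (projectiveSpace (d + 1) k) (𝟙 (projectiveSpace (d + 1) k)) ≫
        genericFibreι (d + 1) B) ≫
      (CartesianMonoidalCategory.fst (projectiveSpace (d + 1) k) B).left).base x' = _
    rw [iK_genericFibreι, Category.assoc, whiskerRight_left_fst, Over.id_left, Category.comp_id]
    exact hfst
  obtain ⟨y, hy, hls⟩ := exists_point_of_fibre_line X i B hB1 htr hpid L' hL'li hL'hom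
    (by rw [hproj]; exact ⟨η, rfl⟩)
  have hyη : y = η := i.left.isClosedEmbedding.injective (hy.trans hproj)
  subst hyη
  exact hls hη2

end Transfer

/-! ### A plane point from a linear form in `𝔭_η` -/

section PlanePoint

variable {k : Type u} [Field k] {d : ℕ} (X : SchemeOver k) (i : X ⟶ projectiveSpace (d + 1) k)
  [IsClosedImmersion i.left]

/-- **A surface point of `M` containing a linear form of `M` in its ideal is a plane point**: for a
`3`-plane `M = V₊(L)` (`c + 3 = d + 1`), `η ∈ X` of dimension `2` with `L ∈ 𝔭_η`, and a linear
form `λ ∈ 𝔭_η` not vanishing on `M̂`, `η` is the generic point of the plane `V₊(L, λ)`, a `2`-plane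
point of `X`. [cite: Hartshorne1977, I Ex. 2.11] -/
theorem isLinearSubspacePoint_two_of_linear_mem {c : ℕ} (hc : c + 3 = d + 1)
    (L : Fin c → MvPolynomial (Fin (d + 1 + 1)) k) (hLhom : ∀ j, (L j).IsHomogeneous 1)
    (hLli : LinearIndependent k L) (M : Submodule k (Fin (d + 1 + 1) → k))
    (hLM : ∀ P : Fin (d + 1 + 1) → k, (∀ j, eval P (L j) = 0) ↔ P ∈ M)
    {η : ↥X.left} (hη2 : height η = 2)
    (hLη : ∀ j, L j ∈ ProjectiveSpectrum.asHomogeneousIdeal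
      (𝒜 := homogeneousSubmodule (Fin (d + 1 + 1)) k) (i.left.base η))
    {lam : MvPolynomial (Fin (d + 1 + 1)) k} (hlam : lam.IsHomogeneous 1)
    (hlamη : lam ∈ ProjectiveSpectrum.asHomogeneousIdeal
      (𝒜 := homogeneousSubmodule (Fin (d + 1 + 1)) k) (i.left.base η))
    (hv₀ : ∃ v ∈ M, eval v lam ≠ 0) :
    IsLinearSubspacePoint 2 (d + 1) i η := by
  obtain ⟨v₀, hv₀M, hv₀⟩ := hv₀
  have hnot : lam ∉ Ideal.span (Set.range L) := by
    intro h
    exact hv₀ (eval_eq_zero_of_mem_idealSpan_of_forall (fun j => ((hLM v₀).2 hv₀M) j) h)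
  have hind : LinearIndependent k (Fin.snoc L lam) := by
    refine linearIndependent_finSnoc.2 ⟨hLli, fun h => hnot ?_⟩
    have hle : Submodule.span k (Set.range L) ≤ (Ideal.span (Set.range L)).restrictScalars k :=
      Submodule.span_le.mpr Ideal.subset_span
    exact hle h
  have hhom' := isHomogeneous_one_snoc hLhom hlam
  have ht : c + 1 ≤ d + 1 := by omega
  have hmem : i.left.base η ∈ ProjectiveSpectrum.zeroLocus (homogeneousSubmodule (Fin (d + 1 + 1)) k)
      (Set.range (Fin.snoc (α := fun _ => MvPolynomial (Fin (d + 1 + 1)) k) L lam)) := by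
    rintro _ ⟨j, rfl⟩
    refine Fin.lastCases ?_ (fun j' => ?_) j
    · rw [Fin.snoc_last]; exact hlamη
    · rw [Fin.snoc_castSucc]; exact hLη j'
  have hiη : height (i.left.base η) = 2 := by
    rw [height_base_eq_of_isClosedImmersion']; exact hη2
  have heq : i.left.base η = linearSubspacePoint (Fin.snoc L lam) hind hhom' ht := by
    by_contra hne
    have hlt := height_lt_of_mem_zeroLocus (Fin.snoc L lam) hind hhom' ht hmem hne
    rw [hiη, show d + 1 - (c + 1) = 2 by omega] at hlt
    exact lt_irrefl _ hlt
  have hideal : (ProjectiveSpectrum.asHomogeneousIdeal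
      (𝒜 := homogeneousSubmodule (Fin (d + 1 + 1)) k) (i.left.base η)).toIdeal =
        Ideal.span (Set.range (Fin.snoc (α := fun _ => MvPolynomial (Fin (d + 1 + 1)) k) L lam)) := by
    rw [heq]; exact toIdeal_linearSubspacePoint (Fin.snoc L lam) hind hhom' ht
  have h := Hypersurface.isLinearSubspacePoint_of_toIdeal_base_eq_span (i := i) (Fin.snoc L lam) hind
    hhom' ht hideal
  rwa [show d + 1 - (c + 1) = 2 by omega] at h

end PlanePoint

/-! ### Algebra of the tangent `3`-plane: `F|_{span(l₀, z)} = γ² (α F'_a(z) + β F'_b(z) + γ F(z))` -/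

section TangentAlgebra

variable {K : Type*} [Field K] [Infinite K] {N : ℕ} {F : MvPolynomial (Fin (N + 1)) K}

/-- **The equation of `X` on a `3`-plane tangent along `l₀ = span(a, b)`**: if `F ≡ 0` on
`span(a, b)` and the polar forms `F'_u = polarForm F u`, `F'_v` vanish on `span(a, b)`
(`M = span(a, b, u, v)` is tangent to `X = V(F)` along `l₀`), then for `x = s a + t b` and
`w ∈ span(u, v)`: `F(x + w) = F'_w(x) + F(w)` with `F'_w(x) = dirD F w x = s F'_a(w) + t F'_b(w)`
linear in `x` — "`span(x, l₀) ∩ S` is a plane cubic containing `l₀` with multiplicity `2`".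
[cite: Mboro2018, proof of Prop. 1.4 (arXiv:1701.04488, p. 8)] -/
theorem eval_add_eq_of_tangent (hF : F.IsHomogeneous 3) {a b u v : Fin (N + 1) → K}
    (hl₀ : ∀ s t : K, eval (s • a + t • b) F = 0)
    (hu : ∀ s t : K, eval (s • a + t • b) (polarForm F u) = 0)
    (hv : ∀ s t : K, eval (s • a + t • b) (polarForm F v) = 0)
    (s t γ₁ γ₂ : K) :
    eval ((s • a + t • b) + (γ₁ • u + γ₂ • v)) F =
      dirD F (γ₁ • u + γ₂ • v) (s • a + t • b) + eval (γ₁ • u + γ₂ • v) F := by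
  rw [eval_add_cubic hF, hl₀, zero_add]
  -- `F'_x(w) = 0` for `x ∈ l₀`, `w ∈ span(u, v)`: the polar forms of `u, v` vanish on `l₀`
  have htan : dirD F (s • a + t • b) (γ₁ • u + γ₂ • v) = 0 := by
    rw [dirD_add_right, dirD_smul_right, dirD_smul_right, ← eval_polarForm, ← eval_polarForm, hu, hv,
      mul_zero, mul_zero, add_zero]
  rw [htan, zero_add]

omit [Infinite K] in
/-- `F'_w(s a + t b) = s F'_w-linear: `dirD F w (s a + t b) = s dirD F w a + t dirD F w b`. [folklore] -/
theorem dirD_add_smul_smul (F : MvPolynomial (Fin (N + 1)) K) (w a b : Fin (N + 1) → K) (s t : K) :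
    dirD F w (s • a + t • b) = s * dirD F w a + t * dirD F w b := by
  rw [dirD_add_right, dirD_smul_right, dirD_smul_right]

/-- **`F'_a` is constant along `l₀`-translates on the tangent plane**: under the tangency hypotheses,
`F'_a(x + w) = F'_a(w)` for `x ∈ span(a, b)`, `w ∈ span(u, v)` (compare the two expansions of
`F(x + w + r a)` in `r`). [folklore] -/
theorem eval_polarForm_add_eq_of_tangent (hF : F.IsHomogeneous 3) {a b u v : Fin (N + 1) → K}
    (hl₀ : ∀ s t : K, eval (s • a + t • b) F = 0)
    (hu : ∀ s t : K, eval (s • a + t • b) (polarForm F u) = 0)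
    (hv : ∀ s t : K, eval (s • a + t • b) (polarForm F v) = 0)
    (s t γ₁ γ₂ : K) :
    eval ((s • a + t • b) + (γ₁ • u + γ₂ • v)) (polarForm F a) = eval (γ₁ • u + γ₂ • v) (polarForm F a) := by
  set x := s • a + t • b with hx
  set w := γ₁ • u + γ₂ • v with hw
  -- two expansions of `F(x + w + r a)`
  have hexp1 : ∀ r : K, eval ((x + w) + r • a) F =
      eval (x + w) F + r * dirD F (x + w) a + r ^ 2 * dirD F a (x + w) + r ^ 3 * eval a F :=
    fun r => eval_add_smul_cubic hF (x + w) a r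
  have hexp2 : ∀ r : K, eval ((x + w) + r • a) F = dirD F w x + r * dirD F w a + eval w F := by
    intro r
    have h := eval_add_eq_of_tangent hF hl₀ hu hv (s + r) t γ₁ γ₂
    have hvec : (x + w) + r • a = ((s + r) • a + t • b) + (γ₁ • u + γ₂ • v) := by
      rw [hx, hw, add_smul]; abel
    rw [hvec, h, ← hw, dirD_add_smul_smul, hx, dirD_add_smul_smul]
    ring
  have hFa : eval a F = 0 := by simpa using hl₀ 1 0
  have h0 : eval (x + w) F = dirD F w x + eval w F := by
    have h := hexp2 0
    rwa [zero_smul, add_zero, zero_mul, add_zero] at h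
  obtain ⟨-, h1, -, -⟩ := coeffs_eq_zero_of_forall_ne_zero (0 : K)
    (dirD F (x + w) a - dirD F w a) (dirD F a (x + w)) (0 : K) (by
      intro r _
      have h := (hexp1 r).symm.trans (hexp2 r)
      rw [h0, hFa] at h
      linear_combination h)
  rw [eval_polarForm, eval_polarForm]
  exact sub_eq_zero.1 h1

/-- **The binary cubic `F(γ₁ u + γ₂ v)`.** [folklore] -/
theorem eval_smul_add_smul_cubic (hF : F.IsHomogeneous 3) (h2 : (2 : K) ≠ 0) (u v : Fin (N + 1) → K)
    (γ₁ γ₂ : K) :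
    eval (γ₁ • u + γ₂ • v) F = γ₁ ^ 3 * eval u F + γ₁ ^ 2 * γ₂ * dirD F u v + γ₁ * γ₂ ^ 2 * dirD F v u +
      γ₂ ^ 3 * eval v F := by
  rw [eval_add_smul_cubic hF, eval_smul_of_isHomogeneous hF, dirD_smul_left hF h2, dirD_smul_right]
  ring

end TangentAlgebra

/-! ### Binary forms: linear factors over an algebraically closed field -/

section Binary

variable {K : Type*} [Field K] [IsAlgClosed K]

/-- **A binary cubic over an algebraically closed field has a linear factor**: for
`(c₀, c₁, c₂, c₃) ≠ 0` there are `(r₁, r₂) ≠ 0` and `e₀, e₁, e₂` with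
`c₀ γ₁³ + c₁ γ₁² γ₂ + c₂ γ₁ γ₂² + c₃ γ₂³ = (r₂ γ₁ - r₁ γ₂)(e₀ γ₁² + e₁ γ₁ γ₂ + e₂ γ₂²)`.
[folklore] -/
theorem exists_linear_factor_cubic (c₀ c₁ c₂ c₃ : K) :
    ∃ r₁ r₂ e₀ e₁ e₂ : K, (r₁ ≠ 0 ∨ r₂ ≠ 0) ∧ ∀ γ₁ γ₂ : K,
      c₀ * γ₁ ^ 3 + c₁ * γ₁ ^ 2 * γ₂ + c₂ * γ₁ * γ₂ ^ 2 + c₃ * γ₂ ^ 3 =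
        (r₂ * γ₁ - r₁ * γ₂) * (e₀ * γ₁ ^ 2 + e₁ * γ₁ * γ₂ + e₂ * γ₂ ^ 2) := by
  by_cases hc₀ : c₀ = 0
  · -- `γ₂` divides
    refine ⟨1, 0, -c₁, -c₂, -c₃, Or.inl one_ne_zero, fun γ₁ γ₂ => ?_⟩
    rw [hc₀]; ring
  · -- a root `r` of `c₀ T³ + c₁ T² + c₂ T + c₃`
    let p : Polynomial K := Polynomial.C c₀ * Polynomial.X ^ 3 + Polynomial.C c₁ * Polynomial.X ^ 2 +
      Polynomial.C c₂ * Polynomial.X + Polynomial.C c₃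
    have hdeg : p.degree = 3 := Polynomial.degree_cubic hc₀
    obtain ⟨r, hr⟩ := IsAlgClosed.exists_root p (by rw [hdeg]; decide)
    have hroot : c₀ * r ^ 3 + c₁ * r ^ 2 + c₂ * r + c₃ = 0 := by
      have h : Polynomial.eval r p = 0 := hr
      simpa [p] using h
    refine ⟨r, 1, c₀, c₁ + c₀ * r, c₂ + c₁ * r + c₀ * r ^ 2, Or.inr one_ne_zero, fun γ₁ γ₂ => ?_⟩
    linear_combination (γ₂ ^ 3) * hroot

/-- **A binary quadratic over an algebraically closed field splits into linear factors**:
`e₀ γ₁² + e₁ γ₁ γ₂ + e₂ γ₂² = (r₂ γ₁ - r₁ γ₂)(f₁ γ₁ + f₂ γ₂)` with `(r₁, r₂) ≠ 0`. [folklore] -/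
theorem exists_linear_factor_quadratic (e₀ e₁ e₂ : K) :
    ∃ r₁ r₂ f₁ f₂ : K, (r₁ ≠ 0 ∨ r₂ ≠ 0) ∧ ∀ γ₁ γ₂ : K,
      e₀ * γ₁ ^ 2 + e₁ * γ₁ * γ₂ + e₂ * γ₂ ^ 2 = (r₂ * γ₁ - r₁ * γ₂) * (f₁ * γ₁ + f₂ * γ₂) := by
  by_cases he₀ : e₀ = 0
  · refine ⟨1, 0, -e₁, -e₂, Or.inl one_ne_zero, fun γ₁ γ₂ => ?_⟩
    rw [he₀]; ring
  · let p : Polynomial K := Polynomial.C e₀ * Polynomial.X ^ 2 + Polynomial.C e₁ * Polynomial.X + Polynomial.C e₂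
    have hdeg : p.degree = 2 := Polynomial.degree_quadratic he₀
    obtain ⟨r, hr⟩ := IsAlgClosed.exists_root p (by rw [hdeg]; decide)
    have hroot : e₀ * r ^ 2 + e₁ * r + e₂ = 0 := by
      have h : Polynomial.eval r p = 0 := hr
      simpa [p] using h
    refine ⟨r, 1, e₀, e₁ + e₀ * r, Or.inr one_ne_zero, fun γ₁ γ₂ => ?_⟩
    linear_combination (γ₂ ^ 2) * hroot

end Binary

/-! ### The residual lines of the planes through `l₀` -/

section Residual

variable {k : Type u} [Field k] {K : Type*} [Field K] [Algebra k K] {N : ℕ}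

/-- A non-trivial quadratic `k`-expression in a transcendental is non-zero. [folklore] -/
theorem algebraMap_quadratic_ne_zero_of_transcendental {τ : K} (hτ : Transcendental k τ) {p₀ p₁ p₂ : k}
    (h : p₀ ≠ 0 ∨ p₁ ≠ 0 ∨ p₂ ≠ 0) :
    algebraMap k K p₀ + τ * algebraMap k K p₁ + τ ^ 2 * algebraMap k K p₂ ≠ 0 := by
  intro h0
  have hP : Polynomial.aeval τ (Polynomial.C p₀ + Polynomial.X * Polynomial.C p₁ +
      Polynomial.X ^ 2 * Polynomial.C p₂) = 0 := by
    rw [map_add, map_add, map_mul, map_mul, map_pow, Polynomial.aeval_C, Polynomial.aeval_X,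
      Polynomial.aeval_C, Polynomial.aeval_C]
    exact h0
  have hz : Polynomial.C p₀ + Polynomial.X * Polynomial.C p₁ + Polynomial.X ^ 2 * Polynomial.C p₂ = 0 :=
    (transcendental_iff_injective.mp hτ) (by rw [hP, map_zero])
  have h0' := congrArg (fun q : Polynomial k => q.coeff 0) hz
  have h1' := congrArg (fun q : Polynomial k => q.coeff 1) hz
  have h2' := congrArg (fun q : Polynomial k => q.coeff 2) hz
  simp only [Polynomial.coeff_add, Polynomial.coeff_X_mul_zero, add_zero,
    Polynomial.coeff_C_succ, Polynomial.coeff_X_mul, zero_add, Polynomial.coeff_zero,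
    Polynomial.coeff_X_pow_mul', Polynomial.coeff_C] at h0' h1' h2'
  simp at h0' h1' h2'
  rcases h with h | h | h
  · exact h h0'
  · exact h h1'
  · exact h h2'

variable [Infinite K]

/-- **Specialising the residual line of the tangent cubic section.** Let `F` be a cubic form over
`k` (`2 ≠ 0`), `(a, b, u, v)` vectors, `ι : k → K`, `τ ∈ K` transcendental; over `K` put
`z = u + τ v`, `A = F'_z(a)`, `B' = F'_z(b)`, `C = F(z)`, `P₁ = -B' a + A b`, `P₂ = -C a + A z`.
If a form `G` over `k` vanishes on `span_K(P₁, P₂)` then `G` vanishes at the points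
`-(v B₀(t) + g C₀(t)) a + v A₀(t) b + g A₀(t) (u + t v)` for all `v, g, t ∈ k`, where
`A₀(t) = F'_{u+tv}(a)`, `B₀(t) = F'_{u+tv}(b)`, `C₀(t) = F(u + t v)` (the residual lines `l_t`).
[folklore] -/
theorem forall_eval_residual_eq_zero_cubic (h2 : (2 : k) ≠ 0) {τ : K} (hτ : Transcendental k τ)
    {F : MvPolynomial (Fin (N + 1)) k} (hF : F.IsHomogeneous 3) (a b u v : Fin (N + 1) → k)
    {G : MvPolynomial (Fin (N + 1)) k}
    (hG : ∀ s t : K,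
      eval (s • ((-(dirD (MvPolynomial.map (algebraMap k K) F)
            ((fun j => algebraMap k K (u j)) + τ • (fun j => algebraMap k K (v j)))
            (fun j => algebraMap k K (b j)))) • (fun j => algebraMap k K (a j)) +
          (dirD (MvPolynomial.map (algebraMap k K) F)
            ((fun j => algebraMap k K (u j)) + τ • (fun j => algebraMap k K (v j)))
            (fun j => algebraMap k K (a j))) • (fun j => algebraMap k K (b j))) +
        t • ((-(eval ((fun j => algebraMap k K (u j)) + τ • (fun j => algebraMap k K (v j)))
            (MvPolynomial.map (algebraMap k K) F))) • (fun j => algebraMap k K (a j)) +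
          (dirD (MvPolynomial.map (algebraMap k K) F)
            ((fun j => algebraMap k K (u j)) + τ • (fun j => algebraMap k K (v j)))
            (fun j => algebraMap k K (a j))) •
            ((fun j => algebraMap k K (u j)) + τ • (fun j => algebraMap k K (v j)))))
        (MvPolynomial.map (algebraMap k K) G) = 0)
    (v₀ g t : k) :
    eval ((-(v₀ * (eval u (polarForm F b) + t * qpolar (polarForm F b) u v + t ^ 2 * eval v (polarForm F b)) +
        g * (eval u F + t * dirD F u v + t ^ 2 * dirD F v u + t ^ 3 * eval v F))) • a +
      (v₀ * (eval u (polarForm F a) + t * qpolar (polarForm F a) u v + t ^ 2 * eval v (polarForm F a))) • b +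
        (g * (eval u (polarForm F a) + t * qpolar (polarForm F a) u v + t ^ 2 * eval v (polarForm F a))) •
          (u + t • v)) G = 0 := by
  set ι := algebraMap k K with hι
  have h2K : (2 : K) ≠ 0 := by rw [← map_ofNat ι 2]; exact (map_ne_zero ι).2 h2
  set FK := MvPolynomial.map ι F with hFKdef
  have hFK : FK.IsHomogeneous 3 := hF.map ι
  -- the path `t ↦ P_t` as a polynomial path of degree `3`
  let V₀ : Fin (N + 1) → k := (-(v₀ * eval u (polarForm F b) + g * eval u F)) • a +
    (v₀ * eval u (polarForm F a)) • b + (g * eval u (polarForm F a)) • u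
  let V₁ : Fin (N + 1) → k := (-(v₀ * qpolar (polarForm F b) u v + g * dirD F u v)) • a +
    (v₀ * qpolar (polarForm F a) u v) • b + (g * qpolar (polarForm F a) u v) • u + (g * eval u (polarForm F a)) • v
  let V₂ : Fin (N + 1) → k := (-(v₀ * eval v (polarForm F b) + g * dirD F v u)) • a +
    (v₀ * eval v (polarForm F a)) • b + (g * eval v (polarForm F a)) • u + (g * qpolar (polarForm F a) u v) • v
  let V₃ : Fin (N + 1) → k := (-(g * eval v F)) • a + (g * eval v (polarForm F a)) • v
  let γ : Fin (N + 1) → Polynomial k := fun j =>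
    Polynomial.C (V₀ j) + Polynomial.C (V₁ j) * Polynomial.X + Polynomial.C (V₂ j) * Polynomial.X ^ 2 +
      Polynomial.C (V₃ j) * Polynomial.X ^ 3
  -- the `K`-quantities
  have hevK : ∀ w : Fin (N + 1) → k, eval (fun j => ι (w j)) FK = ι (eval w F) := fun w => by
    rw [hFKdef, IsCrSystem.eval_map_algebraMap]
  have hpolK : ∀ w : Fin (N + 1) → k, polarForm FK (fun j => ι (w j)) = MvPolynomial.map ι (polarForm F w) :=
    fun w => polarForm_map ι F w
  have hquad : ∀ w : Fin (N + 1) → k, dirD FK ((fun j => ι (u j)) + τ • (fun j => ι (v j))) (fun j => ι (w j)) =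
      ι (eval u (polarForm F w)) + τ * ι (qpolar (polarForm F w) u v) + τ ^ 2 * ι (eval v (polarForm F w)) := by
    intro w
    rw [← eval_polarForm, hpolK]
    have h := eval_add_smul_smul_eq ((isHomogeneous_polarForm hF w).map ι) h2K 1 τ (fun j => ι (u j))
      (fun j => ι (v j))
    rw [one_smul] at h
    rw [h, IsCrSystem.eval_map_algebraMap, IsCrSystem.eval_map_algebraMap, qpolar_map]
    ring
  have hA := hquad a
  have hB := hquad b
  have hdirK : ∀ w w' : Fin (N + 1) → k, dirD FK (fun j => ι (w j)) (fun j => ι (w' j)) = ι (dirD F w w') := by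
    intro w w'
    rw [← eval_polarForm, hpolK, IsCrSystem.eval_map_algebraMap, eval_polarForm]
  have hC : eval ((fun j => ι (u j)) + τ • (fun j => ι (v j))) FK =
      ι (eval u F) + τ * ι (dirD F u v) + τ ^ 2 * ι (dirD F v u) + τ ^ 3 * ι (eval v F) := by
    rw [eval_add_smul_cubic hFK, hevK, hevK, hdirK, hdirK]
  have hpath : eval (fun j => Polynomial.aeval τ (γ j)) (MvPolynomial.map ι G) = 0 := by
    have h := hG (ι v₀) (ι g)
    rw [hA, hB, hC] at h
    have hpt : (fun j => Polynomial.aeval τ (γ j)) =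
        ι v₀ • ((-(ι (eval u (polarForm F b)) + τ * ι (qpolar (polarForm F b) u v) +
              τ ^ 2 * ι (eval v (polarForm F b)))) • (fun j => ι (a j)) +
            (ι (eval u (polarForm F a)) + τ * ι (qpolar (polarForm F a) u v) +
              τ ^ 2 * ι (eval v (polarForm F a))) • (fun j => ι (b j))) +
          ι g • ((-(ι (eval u F) + τ * ι (dirD F u v) + τ ^ 2 * ι (dirD F v u) + τ ^ 3 * ι (eval v F))) •
              (fun j => ι (a j)) +
            (ι (eval u (polarForm F a)) + τ * ι (qpolar (polarForm F a) u v) +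
              τ ^ 2 * ι (eval v (polarForm F a))) • ((fun j => ι (u j)) + τ • (fun j => ι (v j)))) := by
      funext j
      simp only [γ, V₀, V₁, V₂, V₃, map_add, map_mul, Polynomial.aeval_C, Polynomial.aeval_X, map_pow,
        Pi.add_apply, Pi.smul_apply, smul_eq_mul, map_neg]
      ring
    rw [hpt]
    exact h
  have h := eval_path_eq_zero_of_transcendental hτ G γ hpath t
  have hpt : (-(v₀ * (eval u (polarForm F b) + t * qpolar (polarForm F b) u v + t ^ 2 * eval v (polarForm F b)) +
        g * (eval u F + t * dirD F u v + t ^ 2 * dirD F v u + t ^ 3 * eval v F))) • a +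
      (v₀ * (eval u (polarForm F a) + t * qpolar (polarForm F a) u v + t ^ 2 * eval v (polarForm F a))) • b +
        (g * (eval u (polarForm F a) + t * qpolar (polarForm F a) u v + t ^ 2 * eval v (polarForm F a))) •
          (u + t • v) = fun j => (γ j).eval t := by
    funext j
    simp only [γ, V₀, V₁, V₂, V₃, Polynomial.eval_add, Polynomial.eval_mul, Polynomial.eval_C,
      Polynomial.eval_X, Polynomial.eval_pow, Pi.add_apply, Pi.smul_apply, smul_eq_mul]
    ring
  rw [hpt]
  exact h

/-- **The residual lines sweep the tangent cubic section.** Under the tangency hypotheses for the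
frame `(a, b, u, v)` and with `λ_u` a linear form vanishing at `a, b, v`: a form `G` vanishing at
all the points of `forall_eval_residual_eq_zero_cubic` satisfies `G · F'_a · λ_u ≡ 0` on
`{P ∈ span(a, b, u, v) | F(P) = 0}` — a zero `P` with `F'_a(P) ≠ 0`, `λ_u(P) ≠ 0` lies on a
residual line `l_t`. [cite: Mboro2018, proof of Prop. 1.4 (arXiv:1701.04488, p. 8)] -/
theorem eval_mul_mul_eq_zero_of_residual_cubic (h2 : (2 : K) ≠ 0) {F : MvPolynomial (Fin (N + 1)) K}
    (hF : F.IsHomogeneous 3) (n : Fin 4 → Fin (N + 1) → K)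
    (hl₀ : ∀ s t : K, eval (s • n 0 + t • n 1) F = 0)
    (hu : ∀ s t : K, eval (s • n 0 + t • n 1) (polarForm F (n 2)) = 0)
    (hv : ∀ s t : K, eval (s • n 0 + t • n 1) (polarForm F (n 3)) = 0)
    {lamu : MvPolynomial (Fin (N + 1)) K} (hlamu : lamu.IsHomogeneous 1) (hlu0 : eval (n 0) lamu = 0)
    (hlu1 : eval (n 1) lamu = 0) (hlu3 : eval (n 3) lamu = 0)
    {G : MvPolynomial (Fin (N + 1)) K}
    (hG : ∀ v₀ g t : K, eval ((-(v₀ * (eval (n 2) (polarForm F (n 1)) +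
        t * qpolar (polarForm F (n 1)) (n 2) (n 3) + t ^ 2 * eval (n 3) (polarForm F (n 1))) +
        g * (eval (n 2) F + t * dirD F (n 2) (n 3) + t ^ 2 * dirD F (n 3) (n 2) + t ^ 3 * eval (n 3) F))) • n 0 +
      (v₀ * (eval (n 2) (polarForm F (n 0)) + t * qpolar (polarForm F (n 0)) (n 2) (n 3) +
        t ^ 2 * eval (n 3) (polarForm F (n 0)))) • n 1 +
        (g * (eval (n 2) (polarForm F (n 0)) + t * qpolar (polarForm F (n 0)) (n 2) (n 3) +
          t ^ 2 * eval (n 3) (polarForm F (n 0)))) • (n 2 + t • n 3)) G = 0)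
    {P : Fin (N + 1) → K} (hP : P ∈ Submodule.span K (Set.range n)) (hFP : eval P F = 0) :
    eval P (G * (polarForm F (n 0) * lamu)) = 0 := by
  classical
  obtain ⟨cf, rfl⟩ := (Submodule.mem_span_range_iff_exists_fun K).1 hP
  have hGa : (polarForm F (n 0)).IsHomogeneous 2 := isHomogeneous_polarForm hF (n 0)
  have hGb : (polarForm F (n 1)).IsHomogeneous 2 := isHomogeneous_polarForm hF (n 1)
  obtain ⟨φu, hφu⟩ := exists_linearMap_forall_eval_eq hlamu
  have hsum : ∑ c, cf c • n c = (cf 0 • n 0 + cf 1 • n 1) + (cf 2 • n 2 + cf 3 • n 3) := by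
    rw [Fin.sum_univ_four]; abel
  rw [map_mul, map_mul]
  -- `λ_u(P) = γ₁ λ_u(u)`, `F'_a(P) = F'_a(γ₁ u + γ₂ v)`
  have hly : eval (∑ c, cf c • n c) lamu = cf 2 * eval (n 2) lamu := by
    rw [Fin.sum_univ_four, hφu, map_add, map_add, map_add, map_smul, map_smul, map_smul, map_smul, ← hφu,
      ← hφu, ← hφu, ← hφu, hlu0, hlu1, hlu3, smul_zero, smul_zero, smul_zero, zero_add, zero_add,
      add_zero, smul_eq_mul]
  have hla : eval (∑ c, cf c • n c) (polarForm F (n 0)) = eval (cf 2 • n 2 + cf 3 • n 3) (polarForm F (n 0)) := by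
    rw [hsum]
    exact eval_polarForm_add_eq_of_tangent hF hl₀ hu hv (cf 0) (cf 1) (cf 2) (cf 3)
  by_cases hc2 : cf 2 = 0
  · rw [hly, hc2, zero_mul, mul_zero, mul_zero]
  set t := cf 3 / cf 2 with ht
  set z₀ := n 2 + t • n 3 with hz₀
  have hw : cf 2 • n 2 + cf 3 • n 3 = cf 2 • z₀ := by
    rw [hz₀, smul_add, smul_smul, mul_div_cancel₀ _ hc2]
  set A₀ := eval z₀ (polarForm F (n 0)) with hA₀
  set B₀ := eval z₀ (polarForm F (n 1)) with hB₀
  set C₀ := eval z₀ F with hC₀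
  by_cases hA00 : A₀ = 0
  · rw [hla, hw, eval_smul_eq_sq_mul hGa h2, ← hA₀, hA00, mul_zero, zero_mul, mul_zero]
  -- the relation `α A₀ + β B₀ + γ₁ C₀ = 0` from `F(P) = 0`
  have hrel : cf 0 * A₀ + cf 1 * B₀ + cf 2 * C₀ = 0 := by
    have h := hFP
    rw [hsum, eval_add_eq_of_tangent hF hl₀ hu hv, dirD_add_smul_smul, ← eval_polarForm, ← eval_polarForm,
      hw, eval_smul_eq_sq_mul hGa h2, eval_smul_eq_sq_mul hGb h2, eval_smul_of_isHomogeneous hF, ← hA₀,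
      ← hB₀, ← hC₀] at h
    have h' : cf 2 ^ 2 * (cf 0 * A₀ + cf 1 * B₀ + cf 2 * C₀) = 0 := by rw [← h]; ring
    exact (mul_eq_zero.1 h').resolve_left (pow_ne_zero 2 hc2)
  -- the values `A₀, B₀, C₀` as functions of `t`
  have hA₀t : A₀ = eval (n 2) (polarForm F (n 0)) + t * qpolar (polarForm F (n 0)) (n 2) (n 3) +
      t ^ 2 * eval (n 3) (polarForm F (n 0)) := by
    have h := eval_add_smul_smul_eq hGa h2 1 t (n 2) (n 3)
    rw [one_smul] at h
    rw [hA₀, hz₀, h]; ring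
  have hB₀t : B₀ = eval (n 2) (polarForm F (n 1)) + t * qpolar (polarForm F (n 1)) (n 2) (n 3) +
      t ^ 2 * eval (n 3) (polarForm F (n 1)) := by
    have h := eval_add_smul_smul_eq hGb h2 1 t (n 2) (n 3)
    rw [one_smul] at h
    rw [hB₀, hz₀, h]; ring
  have hC₀t : C₀ = eval (n 2) F + t * dirD F (n 2) (n 3) + t ^ 2 * dirD F (n 3) (n 2) + t ^ 3 * eval (n 3) F := by
    rw [hC₀, hz₀, eval_add_smul_cubic hF]
  -- `P = P_t(β / A₀, γ₁ / A₀)`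
  have hG' := hG (cf 1 / A₀) (cf 2 / A₀) t
  rw [← hA₀t, ← hB₀t, ← hC₀t, ← hz₀] at hG'
  have hcoef : -(cf 1 / A₀ * B₀ + cf 2 / A₀ * C₀) = cf 0 := by
    rw [div_mul_eq_mul_div, div_mul_eq_mul_div, ← add_div, ← neg_div, div_eq_iff hA00]
    linear_combination -hrel
  have hPt : ∑ c, cf c • n c = cf 0 • n 0 + cf 1 • n 1 + cf 2 • z₀ := by
    rw [hsum, hw]
  rw [hcoef, div_mul_cancel₀ _ hA00, div_mul_cancel₀ _ hA00, ← hPt] at hG'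
  rw [hG', zero_mul]

end Residual

/-! ### The main construction -/

section Core

variable {k : Type u} [Field k] [IsAlgClosed k] {d : ℕ} (X : SchemeOver k)
  (i : X ⟶ projectiveSpace (d + 1) k) [IsClosedImmersion i.left] {F : MvPolynomial (Fin (d + 1 + 1)) k}

omit [IsClosedImmersion i.left] in
/-- **The polar quadric of a point of `l₀` contains no plane of the tangent `3`-plane, unless it is
all of it** — under the hypothesis that no linear form of `𝔭_η` is non-zero on `M̂`: if
`F'_a ∈ 𝔭_η` and `F'_a` vanishes on a hyperplane `M̂ ∩ V(λ)` of `M̂` then `F'_a ≡ λ λ' mod (L)`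
with `λ λ' ∈ 𝔭_η`, and each factor in `𝔭_η` vanishes on `M̂`. [folklore] -/
theorem forall_eval_eq_zero_of_quadric_vanishing_on_hyperplane {c : ℕ} (hc : c + 3 = d + 1)
    (L : Fin c → MvPolynomial (Fin (d + 1 + 1)) k) (hLhom : ∀ j, (L j).IsHomogeneous 1)
    (hLli : LinearIndependent k L) (n : Fin 4 → Fin (d + 1 + 1) → k)
    (hLM : ∀ P : Fin (d + 1 + 1) → k, (∀ j, eval P (L j) = 0) ↔ P ∈ Submodule.span k (Set.range n))
    {q : MvPolynomial (Fin (d + 1 + 1)) k} (hq : q.IsHomogeneous 2)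
    {η : ↥X.left}
    (hqη : q ∈ ProjectiveSpectrum.asHomogeneousIdeal
      (𝒜 := homogeneousSubmodule (Fin (d + 1 + 1)) k) (i.left.base η))
    (hLη : ∀ j, L j ∈ ProjectiveSpectrum.asHomogeneousIdeal
      (𝒜 := homogeneousSubmodule (Fin (d + 1 + 1)) k) (i.left.base η))
    (hnolin : ∀ lam : MvPolynomial (Fin (d + 1 + 1)) k, lam.IsHomogeneous 1 →
      lam ∈ ProjectiveSpectrum.asHomogeneousIdeal
        (𝒜 := homogeneousSubmodule (Fin (d + 1 + 1)) k) (i.left.base η) →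
        ∀ v ∈ Submodule.span k (Set.range n), eval v lam = 0)
    {lam : MvPolynomial (Fin (d + 1 + 1)) k} (hlam : lam.IsHomogeneous 1)
    (hvan : ∀ v ∈ Submodule.span k (Set.range n), eval v lam = 0 → eval v q = 0)
    (hne : ∃ v ∈ Submodule.span k (Set.range n), eval v lam ≠ 0) :
    ∀ v ∈ Submodule.span k (Set.range n), eval v q = 0 := by
  classical
  obtain ⟨v₀, hv₀M, hv₀⟩ := hne
  have hMvan : ∀ j, ∀ v ∈ Submodule.span k (Set.range n), eval v (L j) = 0 := fun j v hv => ((hLM v).2 hv) j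
  have hlamL : lam ∉ Ideal.span (Set.range L) := fun h =>
    hv₀ (eval_eq_zero_of_mem_idealSpan_of_forall (fun j => hMvan j v₀ hv₀M) h)
  have hLlamli : LinearIndependent k (Fin.snoc L lam) := by
    refine linearIndependent_finSnoc.2 ⟨hLli, fun h => hlamL ?_⟩
    have hle : Submodule.span k (Set.range L) ≤ (Ideal.span (Set.range L)).restrictScalars k :=
      Submodule.span_le.mpr Ideal.subset_span
    exact hle h
  have hLlamhom := isHomogeneous_one_snoc hLhom hlam
  -- a frame of `M̂ ∩ V(λ)` and `q ∈ (L, λ)`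
  obtain ⟨x', hx', hx'van⟩ := exists_frame_of_linearIndependent_linearForms (Fin.snoc L lam) hLlamli hLlamhom
  have h3 : d + 1 + 1 - (c + 1) = 3 := by omega
  let x : Fin 3 → Fin (d + 1 + 1) → k := fun a => x' (a.cast h3.symm)
  have hx : LinearIndependent k x := hx'.comp _ (Fin.cast_injective h3.symm)
  have hxL : ∀ a j, eval (x a) (L j) = 0 := fun a j => by
    have h := hx'van j.castSucc (a.cast h3.symm)
    rwa [Fin.snoc_castSucc] at h
  have hxlam : ∀ a, eval (x a) lam = 0 := fun a => by
    have h := hx'van (Fin.last c) (a.cast h3.symm)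
    rwa [Fin.snoc_last] at h
  have hxm : ∀ a, x a ∈ Submodule.span k (Set.range n) := fun a => (hLM (x a)).1 (hxL a)
  have hxle : Submodule.span k (Set.range x) ≤ Submodule.span k (Set.range n) :=
    Submodule.span_le.2 (by rintro _ ⟨a, rfl⟩; exact hxm a)
  have hlamspan : ∀ v ∈ Submodule.span k (Set.range x), eval v lam = 0 :=
    forall_mem_span_eval_eq_zero_of_isHomogeneous_one hlam (by rintro _ ⟨a, rfl⟩; exact hxlam a)
  have hGvan : ∀ j, ∀ v ∈ Submodule.span k (Set.range x),
      eval v (Fin.snoc (α := fun _ => MvPolynomial (Fin (d + 1 + 1)) k) L lam j) = 0 := by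
    intro j v hv
    refine Fin.lastCases ?_ (fun j' => ?_) j
    · rw [Fin.snoc_last]; exact hlamspan v hv
    · rw [Fin.snoc_castSucc]; exact hMvan j' v (hxle hv)
  have hqmem : q ∈ Ideal.span (Set.range (Fin.snoc L lam)) :=
    mem_idealSpan_of_forall_mem_span_eval_eq_zero hx hLlamli hLlamhom hGvan (by omega)
      (fun v hv => hvan v (hxle hv) (hlamspan v hv))
  obtain ⟨H', hH'hom, hqH'⟩ := exists_eq_sum_mul_of_mem_span_of_isHomogeneous (Fin.snoc L lam) hLlamhom
    hqmem (by norm_num : 1 ≤ 2) hq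
  set lam' : MvPolynomial (Fin (d + 1 + 1)) k := H' (Fin.last c) with hlam'def
  have hlam'hom : lam'.IsHomogeneous 1 := hH'hom (Fin.last c)
  -- `q(v) = lam'(v) lam(v)` on `M̂`
  have hqval : ∀ v ∈ Submodule.span k (Set.range n), eval v q = eval v lam' * eval v lam := by
    intro v hv
    rw [hqH', map_sum, Fin.sum_univ_castSucc]
    simp only [Fin.snoc_castSucc, Fin.snoc_last, map_mul]
    rw [Finset.sum_eq_zero (fun j _ => by rw [hMvan j v hv, mul_zero]), zero_add]
  -- `lam lam' ∈ 𝔭_η`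
  have hqlam' : q - lam * lam' ∈ Ideal.span (Set.range L) := by
    have h : q - lam * lam' = ∑ j : Fin c, H' j.castSucc * L j := by
      rw [hqH', Fin.sum_univ_castSucc]
      simp only [Fin.snoc_castSucc, Fin.snoc_last]
      rw [hlam'def]; ring
    rw [h]
    exact Ideal.sum_mem _ fun j _ => Ideal.mul_mem_left _ _ (Ideal.subset_span ⟨j, rfl⟩)
  have hprime := (i.left.base η).isPrime
  have hprod : lam * lam' ∈ (ProjectiveSpectrum.asHomogeneousIdeal
      (𝒜 := homogeneousSubmodule (Fin (d + 1 + 1)) k) (i.left.base η)).toIdeal := by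
    have hLle : Ideal.span (Set.range L) ≤ (ProjectiveSpectrum.asHomogeneousIdeal
        (𝒜 := homogeneousSubmodule (Fin (d + 1 + 1)) k) (i.left.base η)).toIdeal := by
      rw [Ideal.span_le]; rintro _ ⟨j, rfl⟩; exact hLη j
    have h1 : q - (q - lam * lam') = lam * lam' := by ring
    rw [← h1]
    exact Ideal.sub_mem _ hqη (hLle hqlam')
  intro v hv
  rw [hqval v hv]
  rcases hprime.mem_or_mem hprod with h | h
  · exact absurd (hnolin lam hlam h v₀ hv₀M) hv₀
  · rw [hnolin lam' hlam'hom h v hv, zero_mul]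

/-- **The ruling of the tangent cubic section, from an adapted frame.** Core of
`isLineSweptPoint_of_mem_tangentCubicSection`: `(a, b, u, v) = (n 0, n 1, n 2, n 3)` spans
`M̂ = V(L)`, `F ≡ 0` on `l̂₀ = span(a, b)`, the polar forms `F'_u`, `F'_v` vanish on `l̂₀`
(`M` tangent to `X = V₊(F)` along `l₀`), the polar form `F'_a` is not identically zero on
`span(u, v)`, and no linear form of `𝔭_η` is non-zero on `M̂`. Then `η` (a surface point of
`X ∩ M`) is line-swept: either `F'_a ∈ 𝔭_η` and `η` lies on the quadric `M ∩ V₊(F'_a)`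
(`isLineSweptPoint_of_mem_quadricSurface` on `ℙᵈ⁺¹`, `IsLineSweptPoint.of_base`), or the residual
lines `l_t` of the planes `span(l₀, u + t v)` give a `K`-line of `X_K` specialising to `η`.
[cite: Mboro2018, proof of Prop. 1.4 (arXiv:1701.04488, p. 8)] -/
theorem isLineSweptPoint_of_mem_tangentCubicSection_of_frame (h2 : (2 : k) ≠ 0) {c : ℕ} (hc : c + 3 = d + 1)
    (hF : F.IsHomogeneous 3)
    (hrange : Set.range i.left.base =
      ProjectiveSpectrum.zeroLocus (homogeneousSubmodule (Fin (d + 1 + 1)) k) {F})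
    (L : Fin c → MvPolynomial (Fin (d + 1 + 1)) k) (hLhom : ∀ j, (L j).IsHomogeneous 1)
    (hLli : LinearIndependent k L)
    (n : Fin 4 → Fin (d + 1 + 1) → k) (hn : LinearIndependent k n)
    (hLM : ∀ P : Fin (d + 1 + 1) → k, (∀ j, eval P (L j) = 0) ↔ P ∈ Submodule.span k (Set.range n))
    (hl₀ : ∀ s t : k, eval (s • n 0 + t • n 1) F = 0)
    (hu : ∀ s t : k, eval (s • n 0 + t • n 1) (polarForm F (n 2)) = 0)
    (hv : ∀ s t : k, eval (s • n 0 + t • n 1) (polarForm F (n 3)) = 0)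
    (hA : eval (n 2) (polarForm F (n 0)) ≠ 0 ∨ qpolar (polarForm F (n 0)) (n 2) (n 3) ≠ 0 ∨
      eval (n 3) (polarForm F (n 0)) ≠ 0)
    (hFM : ∃ w ∈ Submodule.span k (Set.range n), eval w F ≠ 0)
    {η : ↥X.left} (hη2 : height η = 2)
    (hLη : ∀ j, L j ∈ ProjectiveSpectrum.asHomogeneousIdeal
      (𝒜 := homogeneousSubmodule (Fin (d + 1 + 1)) k) (i.left.base η))
    (hnolin : ∀ lam : MvPolynomial (Fin (d + 1 + 1)) k, lam.IsHomogeneous 1 →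
      lam ∈ ProjectiveSpectrum.asHomogeneousIdeal
        (𝒜 := homogeneousSubmodule (Fin (d + 1 + 1)) k) (i.left.base η) →
        ∀ v ∈ Submodule.span k (Set.range n), eval v lam = 0) :
    IsLineSweptPoint i η := by
  classical
  set M := Submodule.span k (Set.range n) with hM
  have hMvan : ∀ j, ∀ v ∈ M, eval v (L j) = 0 := fun j v hv => ((hLM v).2 hv) j
  have hnmem : ∀ c', n c' ∈ M := fun c' => Submodule.subset_span ⟨c', rfl⟩
  set Ga := polarForm F (n 0) with hGadef
  set Gb := polarForm F (n 1) with hGbdef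
  have hGa : Ga.IsHomogeneous 2 := isHomogeneous_polarForm hF (n 0)
  have hiη : height (i.left.base η) = 2 := by rw [height_base_eq_of_isClosedImmersion']; exact hη2
  have hFη : F ∈ ProjectiveSpectrum.asHomogeneousIdeal
      (𝒜 := homogeneousSubmodule (Fin (d + 1 + 1)) k) (i.left.base η) := by
    have hmem : i.left.base η ∈ Set.range i.left.base := ⟨η, rfl⟩
    rw [hrange] at hmem
    exact hmem (Set.mem_singleton F)
  -- a point of `span(u, v)` where `F'_a ≠ 0`
  have hGane : ∃ w ∈ M, eval w Ga ≠ 0 := by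
    by_cases hu0 : eval (n 2) Ga = 0
    · by_cases hv0 : eval (n 3) Ga = 0
      · have hq : qpolar Ga (n 2) (n 3) ≠ 0 := by
          rcases hA with h | h | h
          · exact absurd hu0 h
          · exact h
          · exact absurd hv0 h
        refine ⟨n 2 + n 3, Submodule.add_mem _ (hnmem 2) (hnmem 3), ?_⟩
        rw [eval_add_eq_qpolar hGa h2, hu0, hv0, zero_add, add_zero]
        exact hq
      · exact ⟨n 3, hnmem 3, hv0⟩
    · exact ⟨n 2, hnmem 2, hu0⟩
  -- FIRST BRANCH: `F'_a ∈ 𝔭_η`: `η` lies on the polar quadric, which contains no plane of `M`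
  by_cases hGaη : Ga ∈ ProjectiveSpectrum.asHomogeneousIdeal
      (𝒜 := homogeneousSubmodule (Fin (d + 1 + 1)) k) (i.left.base η)
  · have hnoplane : ∀ lam : MvPolynomial (Fin (d + 1 + 1)) k, lam.IsHomogeneous 1 →
        (∀ v ∈ Submodule.span k (Set.range n), eval v lam = 0 → eval v Ga = 0) →
          ∀ v ∈ Submodule.span k (Set.range n), eval v lam = 0 := by
      intro lam hlam hvan
      by_contra hne
      push Not at hne
      obtain ⟨w, hwM, hw⟩ := hGane
      exact hw (forall_eval_eq_zero_of_quadric_vanishing_on_hyperplane X i hc L hLhom hLli n hLM hGa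
        hGaη hLη hnolin hlam hvan hne w hwM)
    haveI : IsClosedImmersion (CommaMorphism.left (𝟙 (projectiveSpace (d + 1) k))) := by
      change IsClosedImmersion (𝟙 ((projectiveSpace (d + 1) k).left)); infer_instance
    have hP : IsLineSweptPoint (𝟙 (projectiveSpace (d + 1) k)) (i.left.base η) :=
      isLineSweptPoint_of_mem_quadricSurface (projectiveSpace (d + 1) k) (𝟙 (projectiveSpace (d + 1) k)) h2 hc
        L hLhom hLli n hn hLM hGa hnoplane (fun x _ => ⟨x, rfl⟩) (η := i.left.base η) hiη hGaη hLη
    exact hP.of_base hη2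
  -- SECOND BRANCH: the residual lines over the abstract curve
  -- dual forms `λ_b`, `λ_u`
  have h023 : LinearIndependent k ![n 0, n 2, n 3] := by
    have h := hn.comp ![(0 : Fin 4), 2, 3] (by decide)
    convert h using 1
    funext a; fin_cases a <;> rfl
  have h1 : n 1 ∉ Submodule.span k (Set.range ![n 0, n 2, n 3]) := by
    rw [range_vec3_eq_image]; exact hn.notMem_span_image (s := {0, 2, 3}) (x := 1) (by decide)
  obtain ⟨lamb, hlambhom, hlambvan, hlambb⟩ := exists_linearForm_vanishing_eval_ne_zero h023 h1
  have hlb0 : eval (n 0) lamb = 0 := hlambvan _ (Submodule.subset_span ⟨0, rfl⟩)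
  have hlb2 : eval (n 2) lamb = 0 := hlambvan _ (Submodule.subset_span ⟨1, rfl⟩)
  have hlb3 : eval (n 3) lamb = 0 := hlambvan _ (Submodule.subset_span ⟨2, rfl⟩)
  have h013 : LinearIndependent k ![n 0, n 1, n 3] := by
    have h := hn.comp ![(0 : Fin 4), 1, 3] (by decide)
    convert h using 1
    funext a; fin_cases a <;> rfl
  have h2' : n 2 ∉ Submodule.span k (Set.range ![n 0, n 1, n 3]) := by
    rw [range_vec3_eq_image]; exact hn.notMem_span_image (s := {0, 1, 3}) (x := 2) (by decide)
  obtain ⟨lamy, hlamyhom, hlamyvan, hlamyy⟩ := exists_linearForm_vanishing_eval_ne_zero h013 h2'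
  have hly0 : eval (n 0) lamy = 0 := hlamyvan _ (Submodule.subset_span ⟨0, rfl⟩)
  have hly1 : eval (n 1) lamy = 0 := hlamyvan _ (Submodule.subset_span ⟨1, rfl⟩)
  have hly3 : eval (n 3) lamy = 0 := hlamyvan _ (Submodule.subset_span ⟨2, rfl⟩)
  -- the line forms of `l̂₀ = span(a, b)` over `k`: `F, F'_u, F'_v, F'_a, F'_b` vanish on `l̂₀`
  have h01 : LinearIndependent k ![n 0, n 1] := by
    have h := hn.comp ![(0 : Fin 4), 1] (by decide)
    convert h using 1
    funext a; fin_cases a <;> rfl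
  haveI : Infinite k := inferInstance
  obtain ⟨cl, Lab, -, -, hLabhom, hLabvan, hLabideal⟩ := exists_linearForms_forall_mem_ideal_span_vanishing h01
  have hspan01 : ∀ {G : MvPolynomial (Fin (d + 1 + 1)) k}, (∀ s t : k, eval (s • n 0 + t • n 1) G = 0) →
      G ∈ Ideal.span (Set.range Lab) := by
    intro G hG
    refine hLabideal G fun w hw => ?_
    obtain ⟨cf, rfl⟩ := (Submodule.mem_span_range_iff_exists_fun k).1 hw
    rw [Fin.sum_univ_two]
    exact hG (cf 0) (cf 1)
  have hGa0 : ∀ s t : k, eval (s • n 0 + t • n 1) Ga = 0 := by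
    intro s t
    rw [hGadef, eval_polarForm]
    refine dirD_eq_zero_of_forall_eval_add_smul fun r => ?_
    have hvec : s • n 0 + t • n 1 + r • n 0 = (s + r) • n 0 + t • n 1 := by rw [add_smul]; abel
    rw [hvec]; exact hl₀ (s + r) t
  have hGb0 : ∀ s t : k, eval (s • n 0 + t • n 1) Gb = 0 := by
    intro s t
    rw [hGbdef, eval_polarForm]
    refine dirD_eq_zero_of_forall_eval_add_smul fun r => ?_
    have hvec : s • n 0 + t • n 1 + r • n 1 = s • n 0 + (t + r) • n 1 := by rw [add_smul]; abel
    rw [hvec]; exact hl₀ s (t + r)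
  -- the curve `B`, `K = k(B)`, `τ` transcendental
  obtain ⟨B, _, _, hB1, htr, hpid⟩ := exists_regularProperCurve k
  set K := B.left.functionField with hK
  obtain ⟨τ, hτ⟩ := exists_transcendental_of_trdeg_eq_one htr
  let ι : k →+* K := algebraMap k K
  haveI : Infinite K := Infinite.of_injective ι ι.injective
  have h2K : (2 : K) ≠ 0 := by rw [← map_ofNat ι 2]; exact (map_ne_zero ι).2 h2
  set FK := MvPolynomial.map ι F with hFKdef
  have hFK : FK.IsHomogeneous 3 := hF.map ι
  -- the `K`-vectors
  set a' : Fin (d + 1 + 1) → K := fun j => ι (n 0 j) with ha'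
  set b' : Fin (d + 1 + 1) → K := fun j => ι (n 1 j) with hb'
  set u' : Fin (d + 1 + 1) → K := fun j => ι (n 2 j) with hu'
  set v' : Fin (d + 1 + 1) → K := fun j => ι (n 3 j) with hv'
  set z' : Fin (d + 1 + 1) → K := u' + τ • v' with hz'
  set A : K := dirD FK z' a' with hAdef
  set Bf : K := dirD FK z' b' with hBfdef
  set C : K := eval z' FK with hCdef
  have hpolK : ∀ w : Fin (d + 1 + 1) → k, polarForm FK (fun j => ι (w j)) = MvPolynomial.map ι (polarForm F w) :=
    fun w => by rw [hFKdef]; exact polarForm_map ι F w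
  have hevK : ∀ w : Fin (d + 1 + 1) → k, eval (fun j => ι (w j)) FK = ι (eval w F) := fun w => by
    rw [hFKdef, IsCrSystem.eval_map_algebraMap]
  have hAval : A = ι (eval (n 2) Ga) + τ * ι (qpolar Ga (n 2) (n 3)) + τ ^ 2 * ι (eval (n 3) Ga) := by
    rw [hAdef, ← eval_polarForm, ha', hpolK, ← hGadef, hz', hu', hv']
    have h := eval_add_smul_smul_eq (hGa.map ι) h2K 1 τ (fun j => ι (n 2 j)) (fun j => ι (n 3 j))
    rw [one_smul] at h
    rw [h, IsCrSystem.eval_map_algebraMap, IsCrSystem.eval_map_algebraMap, qpolar_map]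
    ring
  have hA0 : A ≠ 0 := by rw [hAval]; exact algebraMap_quadratic_ne_zero_of_transcendental hτ hA
  set P₁ : Fin (d + 1 + 1) → K := (-Bf) • a' + A • b' with hP₁
  set P₂ : Fin (d + 1 + 1) → K := (-C) • a' + A • z' with hP₂
  -- `P₁, P₂` are independent
  obtain ⟨φb, hφb⟩ := exists_linearMap_forall_eval_eq (hlambhom.map ι)
  obtain ⟨φy, hφy⟩ := exists_linearMap_forall_eval_eq (hlamyhom.map ι)
  have vb0 : φb a' = 0 := by rw [← hφb, ha', IsCrSystem.eval_map_algebraMap, hlb0, map_zero]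
  have vb1 : φb b' = ι (eval (n 1) lamb) := by rw [← hφb, hb', IsCrSystem.eval_map_algebraMap]
  have vb2 : φb u' = 0 := by rw [← hφb, hu', IsCrSystem.eval_map_algebraMap, hlb2, map_zero]
  have vb3 : φb v' = 0 := by rw [← hφb, hv', IsCrSystem.eval_map_algebraMap, hlb3, map_zero]
  have vy0 : φy a' = 0 := by rw [← hφy, ha', IsCrSystem.eval_map_algebraMap, hly0, map_zero]
  have vy1 : φy b' = 0 := by rw [← hφy, hb', IsCrSystem.eval_map_algebraMap, hly1, map_zero]
  have vy2 : φy u' = ι (eval (n 2) lamy) := by rw [← hφy, hu', IsCrSystem.eval_map_algebraMap]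
  have vy3 : φy v' = 0 := by rw [← hφy, hv', IsCrSystem.eval_map_algebraMap, hly3, map_zero]
  have hP : LinearIndependent K ![P₁, P₂] := by
    refine linearIndependent_pair_of_linearMap φb φy ?_ ?_ ?_ ?_
    · rw [hP₁, map_add, map_smul, map_smul, vb0, vb1, smul_zero, zero_add, smul_eq_mul]
      exact mul_ne_zero hA0 ((map_ne_zero ι).2 hlambb)
    · rw [hP₂, hz', map_add, map_smul, map_smul, map_add, map_smul, vb0, vb2, vb3, smul_zero, smul_zero,
        add_zero, smul_zero, add_zero]
    · rw [hP₁, map_add, map_smul, map_smul, vy0, vy1, smul_zero, smul_zero, add_zero]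
    · rw [hP₂, hz', map_add, map_smul, map_smul, map_add, map_smul, vy0, vy2, vy3, smul_zero, zero_add,
        smul_zero, add_zero, smul_eq_mul]
      exact mul_ne_zero hA0 ((map_ne_zero ι).2 hlamyy)
  -- the line `l_τ = span(P₁, P₂)` and its forms `μ`
  obtain ⟨μ, hμli, hμhom, hμv, hμideal⟩ := exists_lineForms ![P₁, P₂] hP (by omega : 1 ≤ d + 1)
  have hvanμ : ∀ G ∈ Ideal.span (Set.range μ), ∀ s t : K, eval (s • P₁ + t • P₂) G = 0 := by
    intro G hG s t
    refine eval_eq_zero_of_mem_idealSpan_of_forall (fun l => ?_) hG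
    rw [eval_add_smul_smul_of_isHomogeneous_one (hμhom l)]
    have h0 : eval P₁ (μ l) = 0 := hμv l 0
    have h1 : eval P₂ (μ l) = 0 := hμv l 1
    rw [h0, h1, mul_zero, mul_zero, add_zero]
  -- points of `l_τ` are combinations of `a', b', z'`; they lie on `S_K` and `M_K`
  have hcomb : ∀ s t : K, s • P₁ + t • P₂ = ((-(s * Bf + t * C)) • a' + (s * A) • b') + (t * A) • z' := by
    intro s t
    rw [hP₁, hP₂]
    funext j
    simp only [Pi.add_apply, Pi.smul_apply, smul_eq_mul, neg_mul]
    ring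
  have hspanK : ∀ s t : K, s • P₁ + t • P₂ ∈ Submodule.span K (Set.range fun c' j => ι (n c' j)) := by
    intro s t
    rw [hcomb, hz']
    refine Submodule.add_mem _ (Submodule.add_mem _ (Submodule.smul_mem _ _ (Submodule.subset_span ⟨0, rfl⟩))
      (Submodule.smul_mem _ _ (Submodule.subset_span ⟨1, rfl⟩))) (Submodule.smul_mem _ _ ?_)
    exact Submodule.add_mem _ (Submodule.subset_span ⟨2, rfl⟩)
      (Submodule.smul_mem _ _ (Submodule.subset_span ⟨3, rfl⟩))
  -- `k`-forms vanishing on `l̂₀` vanish, after scalar extension, on `span_K(a', b')`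
  have hvan01K : ∀ {G : MvPolynomial (Fin (d + 1 + 1)) k}, (∀ s t : k, eval (s • n 0 + t • n 1) G = 0) →
      ∀ s t : K, eval (s • a' + t • b') (MvPolynomial.map ι G) = 0 := by
    intro G hG s t
    have hmem : MvPolynomial.map ι G ∈ Ideal.span (Set.range fun j => MvPolynomial.map ι (Lab j)) := by
      have h := Ideal.mem_map_of_mem (MvPolynomial.map ι) (hspan01 hG)
      rw [Ideal.map_span] at h
      refine (Ideal.span_mono ?_) h
      rintro _ ⟨_, ⟨j, rfl⟩, rfl⟩
      exact ⟨j, rfl⟩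
    refine eval_eq_zero_of_mem_idealSpan_of_forall (fun j => ?_) hmem
    have hL0 : eval (n 0) (Lab j) = 0 := hLabvan j _ (Submodule.subset_span ⟨0, rfl⟩)
    have hL1 : eval (n 1) (Lab j) = 0 := hLabvan j _ (Submodule.subset_span ⟨1, rfl⟩)
    rw [eval_add_smul_smul_of_isHomogeneous_one ((hLabhom j).map ι), ha', hb', IsCrSystem.eval_map_algebraMap,
      IsCrSystem.eval_map_algebraMap, hL0, hL1, map_zero, mul_zero, mul_zero, add_zero]
  have hl₀K : ∀ s t : K, eval (s • a' + t • b') FK = 0 := fun s t => by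
    rw [hFKdef]; exact hvan01K hl₀ s t
  have huK : ∀ s t : K, eval (s • a' + t • b') (polarForm FK u') = 0 := fun s t => by
    rw [hu', hpolK]; exact hvan01K hu s t
  have hvK : ∀ s t : K, eval (s • a' + t • b') (polarForm FK v') = 0 := fun s t => by
    rw [hv', hpolK]; exact hvan01K hv s t
  -- `F_K` vanishes on `l_τ`
  have hFl : ∀ s t : K, eval (s • P₁ + t • P₂) FK = 0 := by
    intro s t
    rw [hcomb, hz']
    have hzK : (t * A) • (u' + τ • v') = (t * A) • u' + (t * A * τ) • v' := by
      rw [smul_add, smul_smul]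
    rw [hzK, eval_add_eq_of_tangent hFK hl₀K huK hvK, dirD_add_smul_smul, ← hzK, ← hz',
      dirD_smul_left hFK h2K, dirD_smul_left hFK h2K, ← hAdef, ← hBfdef, eval_smul_of_isHomogeneous hFK,
      ← hCdef]
    ring
  have hLl : ∀ j, ∀ s t : K, eval (s • P₁ + t • P₂) (MvPolynomial.map ι (L j)) = 0 := by
    intro j s t
    refine forall_mem_span_eval_eq_zero_of_isHomogeneous_one ((hLhom j).map ι) ?_ _ (hspanK s t)
    rintro _ ⟨c', rfl⟩
    rw [IsCrSystem.eval_map_algebraMap, hMvan j _ (hnmem c'), map_zero]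
  have hFμ : FK ∈ Ideal.span (Set.range μ) := hμideal _ hFl
  have hLμ : ∀ j, MvPolynomial.map ι (L j) ∈ Ideal.span (Set.range μ) := fun j => hμideal _ (hLl j)
  set lamK := linearSubspacePoint μ hμli hμhom (Nat.sub_le (d + 1) 1) with hlamK
  -- membership in `𝔭_{π(l_τ)}`
  have hmemπ : ∀ G : MvPolynomial (Fin (d + 1 + 1)) k,
      G ∈ ProjectiveSpectrum.asHomogeneousIdeal (𝒜 := homogeneousSubmodule (Fin (d + 1 + 1)) k)
        (projMap (d := d + 1) k K lamK) ↔ MvPolynomial.map ι G ∈ Ideal.span (Set.range μ) := by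
    intro G
    rw [mem_asHomogeneousIdeal_projMap_iff, ← HomogeneousIdeal.mem_iff, hlamK, toIdeal_linearSubspacePoint]
  -- `π(l_τ)` lies on `X`
  have hmemX : projMap (d := d + 1) k K lamK ∈ Set.range i.left.base := by
    rw [hrange]
    intro G hG
    rw [Set.mem_singleton_iff.mp hG]
    exact (hmemπ _).2 (by rw [← hFKdef]; exact hFμ)
  obtain ⟨yQ, hyQ, hls⟩ := exists_point_of_fibre_line X i B hB1 htr hpid μ hμli hμhom hmemX
  -- KEY: homogeneous forms vanishing on `l_τ` lie in `𝔭_η`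
  have key : ∀ G : MvPolynomial (Fin (d + 1 + 1)) k, SetLike.IsHomogeneousElem
      (homogeneousSubmodule (Fin (d + 1 + 1)) k) G → MvPolynomial.map ι G ∈ Ideal.span (Set.range μ) →
      G ∈ ProjectiveSpectrum.asHomogeneousIdeal (𝒜 := homogeneousSubmodule (Fin (d + 1 + 1)) k)
        (i.left.base η) := by
    rintro G ⟨e, he⟩ hG
    have hGhom : G.IsHomogeneous e := (mem_homogeneousSubmodule e G).1 he
    rcases Nat.eq_zero_or_pos e with rfl | hepos
    · -- constants: `G = C c`, and `c = 0` since `(μ)` is proper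
      have hGC : G = MvPolynomial.C (coeff 0 G) :=
        totalDegree_eq_zero_iff_eq_C.1 ((totalDegree_zero_iff_isHomogeneous _).2 hGhom)
      by_cases hc0 : coeff 0 G = 0
      · rw [hGC, hc0, map_zero]; exact zero_mem _
      · exfalso
        have hunit : IsUnit (MvPolynomial.map ι G) := by
          rw [hGC, MvPolynomial.map_C]
          exact (isUnit_iff_ne_zero.2 ((map_ne_zero ι).2 hc0)).map MvPolynomial.C
        have htop : Ideal.span (Set.range μ) = ⊤ := Ideal.eq_top_of_isUnit_mem _ hG hunit
        have hne : (ProjectiveSpectrum.asHomogeneousIdeal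
            (𝒜 := homogeneousSubmodule (Fin (d + 1 + 1)) K) lamK).toIdeal ≠ ⊤ := lamK.isPrime.ne_top
        rw [hlamK, toIdeal_linearSubspacePoint] at hne
        exact hne htop
    · -- (i) `G ⊗ 1` vanishes on `l_τ`; (ii) `G` vanishes on the residual lines `l_t`
      have hGl := hvanμ _ hG
      have hGt := forall_eval_residual_eq_zero_cubic h2 hτ hF (n 0) (n 1) (n 2) (n 3) (G := G) (by
        intro s t
        have h := hGl s t
        rw [hP₁, hP₂, hAdef, hBfdef, hCdef, hz', ha', hb', hu', hv', hFKdef] at h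
        exact h)
      -- (iii) `G F'_a λ_u` vanishes on `S(k)`
      have hGZ := fun P (hPM : P ∈ M) (hFP : eval P F = 0) =>
        eval_mul_mul_eq_zero_of_residual_cubic h2 hF n hl₀ hu hv hlamyhom hly0 hly1 hly3 hGt hPM hFP
      -- (iv) Nullstellensatz
      set I : Ideal (MvPolynomial (Fin (d + 1 + 1)) k) := Ideal.span (insert F (Set.range L)) with hI
      have hvan : G * (Ga * lamy) ∈ MvPolynomial.vanishingIdeal k (MvPolynomial.zeroLocus k I) := by
        rw [MvPolynomial.mem_vanishingIdeal_iff]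
        intro x hx
        rw [MvPolynomial.mem_zeroLocus_iff] at hx
        have hxF : eval x F = 0 := by
          have h := hx F (Ideal.subset_span (Set.mem_insert _ _))
          rwa [show aeval x F = eval x F from congrFun (MvPolynomial.aeval_eq_eval (f := x)) F] at h
        have hxL : ∀ j, eval x (L j) = 0 := by
          intro j
          have h := hx (L j) (Ideal.subset_span (Set.mem_insert_of_mem _ ⟨j, rfl⟩))
          rwa [show aeval x (L j) = eval x (L j) from congrFun (MvPolynomial.aeval_eq_eval (f := x)) _] at h
        rw [show aeval x (G * (Ga * lamy)) = eval x (G * (Ga * lamy))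
          from congrFun (MvPolynomial.aeval_eq_eval (f := x)) _]
        exact hGZ x ((hLM x).1 hxL) hxF
      rw [MvPolynomial.vanishingIdeal_zeroLocus_eq_radical] at hvan
      obtain ⟨N₀, hN₀⟩ := Ideal.mem_radical_iff.1 hvan
      have hIle : I ≤ (ProjectiveSpectrum.asHomogeneousIdeal (𝒜 := homogeneousSubmodule (Fin (d + 1 + 1)) k)
          (i.left.base η)).toIdeal := by
        rw [hI, Ideal.span_le]
        rintro G' hG'
        rcases hG' with rfl | ⟨j, rfl⟩
        · exact hFη
        · exact hLη j
      have hprime := (i.left.base η).isPrime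
      have hmem : G * (Ga * lamy) ∈ (ProjectiveSpectrum.asHomogeneousIdeal
          (𝒜 := homogeneousSubmodule (Fin (d + 1 + 1)) k) (i.left.base η)).toIdeal :=
        hprime.mem_of_pow_mem N₀ (hIle hN₀)
      -- (v) the other factors are not in `𝔭_η`
      rcases hprime.mem_or_mem hmem with h | h
      · exact h
      · exfalso
        rcases hprime.mem_or_mem h with h' | h'
        · exact hGaη h'
        · exact hlamyy (hnolin _ hlamyhom h' _ (hnmem 2))
  -- `y_Q ⤳ η`
  have hspec : i.left.base yQ ⤳ i.left.base η := by
    rw [hyQ]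
    refine specializes_iff_le.2 ?_
    rw [← (ProjectiveSpectrum.asHomogeneousIdeal (𝒜 := homogeneousSubmodule (Fin (d + 1 + 1)) k)
      (projMap (d := d + 1) k K lamK)).isHomogeneous.toIdeal_homogeneousCore_eq_self]
    change Ideal.span _ ≤ _
    refine Ideal.span_le.2 ?_
    rintro _ ⟨⟨G, hGhom⟩, hGmem, rfl⟩
    exact key G hGhom ((hmemπ G).1 hGmem)
  -- `dim y_Q = 2`
  have hge : (2 : ℕ∞) ≤ height (i.left.base yQ) := by
    rw [← hiη]
    exact Order.height_mono (Scheme.le_iff_specializes.2 hspec)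
  have hFnot : F ∉ Ideal.span (Set.range L) := by
    intro h
    obtain ⟨w, hwM, hw⟩ := hFM
    exact hw (eval_eq_zero_of_mem_idealSpan_of_forall (fun j => hMvan j w hwM) h)
  have hlt : height (i.left.base yQ) < ((d + 1 - c : ℕ) : ℕ∞) := by
    have hcle : c ≤ d + 1 := by omega
    refine height_lt_of_mem_zeroLocus L hLli hLhom hcle ?_ ?_
    · rintro _ ⟨j, rfl⟩
      rw [hyQ]
      exact (hmemπ _).2 (hLμ j)
    · intro heq
      apply hFnot
      rw [← toIdeal_linearSubspacePoint L hLli hLhom hcle, ← heq, hyQ]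
      exact (hmemπ _).2 (by rw [← hFKdef]; exact hFμ)
  rw [show d + 1 - c = 3 by omega] at hlt
  have hyQi2 : height (i.left.base yQ) = 2 := by
    have hne : height (i.left.base yQ) ≠ ⊤ := ne_top_of_lt hlt
    obtain ⟨m, hm⟩ := ENat.ne_top_iff_exists.1 hne
    rw [← hm] at hge hlt ⊢
    have h1 : (2 : ℕ) ≤ m := by exact_mod_cast hge
    have h2 : m < 3 := by exact_mod_cast hlt
    have h3 : m = 2 := by omega
    rw [h3]; rfl
  have hyQ2 : height yQ = 2 := by rw [← height_base_eq_of_isClosedImmersion' i.left]; exact hyQi2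
  have heqη : i.left.base yQ = i.left.base η :=
    eq_of_specializes_of_height_eq hspec (by rw [hiη, hyQi2]) (by rw [hyQi2]; exact WithTop.coe_lt_top _)
  have hyη : yQ = η := i.left.isClosedEmbedding.injective heqη
  rw [← hyη]
  exact hls hyQ2

end Core

/-! ### The theorem -/

section Main

variable {k : Type u} [Field k] [IsAlgClosed k] {d : ℕ} (X : SchemeOver k)
  (i : X ⟶ projectiveSpace (d + 1) k) [IsClosedImmersion i.left] {F : MvPolynomial (Fin (d + 1 + 1)) k}

/-- **Cubic surfaces cut by a `3`-plane tangent along a line are line-swept** (Mboro, proof of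
Prop. 1.4). Let `X = V₊(F) ⊆ ℙᵈ⁺¹_k` (`k` algebraically closed, `2 ≠ 0`, `F` a cubic form) and
`M = V₊(L)` a `3`-plane with frame `(a, b, u, v)` of `M̂` such that `F ≡ 0` on `l̂₀ = span(a, b)`
(a line `l₀ ⊆ X`), the polar forms `F'_u`, `F'_v` vanish on `l̂₀` (`M` is tangent to `X` along `l₀`)
and `F ≢ 0` on `M̂` (`M ⊄ X`). Then every point `η ∈ X` of dimension `2` lying on `M` (`L ∈ 𝔭_η`) —
every component of the cubic surface `S = X ∩ M`, singular along `l₀` — is LINE-SWEPT: `S` "is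
ruled by lines of `X`: for any `x ∈ S ∖ l₀`, `span(x, l₀) ∩ S` is a plane cubic containing `l₀`
with multiplicity `2`, so that the residual curve is a line passing through `x`".
[cite: Mboro2018, proof of Prop. 1.4 (arXiv:1701.04488, p. 8)] -/
theorem isLineSweptPoint_of_mem_tangentCubicSection (h2 : (2 : k) ≠ 0) {c : ℕ} (hc : c + 3 = d + 1)
    (hF : F.IsHomogeneous 3)
    (hrange : Set.range i.left.base =
      ProjectiveSpectrum.zeroLocus (homogeneousSubmodule (Fin (d + 1 + 1)) k) {F})
    (L : Fin c → MvPolynomial (Fin (d + 1 + 1)) k) (hLhom : ∀ j, (L j).IsHomogeneous 1)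
    (hLli : LinearIndependent k L)
    (n : Fin 4 → Fin (d + 1 + 1) → k) (hn : LinearIndependent k n)
    (hLM : ∀ P : Fin (d + 1 + 1) → k, (∀ j, eval P (L j) = 0) ↔ P ∈ Submodule.span k (Set.range n))
    (hl₀ : ∀ s t : k, eval (s • n 0 + t • n 1) F = 0)
    (hu : ∀ s t : k, eval (s • n 0 + t • n 1) (polarForm F (n 2)) = 0)
    (hv : ∀ s t : k, eval (s • n 0 + t • n 1) (polarForm F (n 3)) = 0)
    (hFM : ∃ w ∈ Submodule.span k (Set.range n), eval w F ≠ 0)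
    {η : ↥X.left} (hη2 : height η = 2)
    (hLη : ∀ j, L j ∈ ProjectiveSpectrum.asHomogeneousIdeal
      (𝒜 := homogeneousSubmodule (Fin (d + 1 + 1)) k) (i.left.base η)) :
    IsLineSweptPoint i η := by
  classical
  set M := Submodule.span k (Set.range n) with hM
  have hMvan : ∀ j, ∀ v ∈ M, eval v (L j) = 0 := fun j v hv => ((hLM v).2 hv) j
  have hnmem : ∀ c', n c' ∈ M := fun c' => Submodule.subset_span ⟨c', rfl⟩
  -- CASE A: a linear form of `𝔭_η` non-zero on `M̂`: `η` is a plane point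
  by_cases hlin : ∃ lam : MvPolynomial (Fin (d + 1 + 1)) k, lam.IsHomogeneous 1 ∧
      lam ∈ ProjectiveSpectrum.asHomogeneousIdeal (𝒜 := homogeneousSubmodule (Fin (d + 1 + 1)) k)
        (i.left.base η) ∧ ∃ v ∈ M, eval v lam ≠ 0
  · obtain ⟨lam, hlam, hlamη, hne⟩ := hlin
    exact IsLinearSubspacePoint.isLineSweptPoint (by omega)
      (isLinearSubspacePoint_two_of_linear_mem X i hc L hLhom hLli M hLM hη2 hLη hlam hlamη hne)
  have hnolin : ∀ lam : MvPolynomial (Fin (d + 1 + 1)) k, lam.IsHomogeneous 1 →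
      lam ∈ ProjectiveSpectrum.asHomogeneousIdeal (𝒜 := homogeneousSubmodule (Fin (d + 1 + 1)) k)
        (i.left.base η) → ∀ v ∈ M, eval v lam = 0 := by
    intro lam hlam hlamη v hv
    by_contra hne
    exact hlin ⟨lam, hlam, hlamη, v, hv, hne⟩
  -- CASE B: WLOG `F'_a ≢ 0` on `span(u, v)`
  by_cases hA : eval (n 2) (polarForm F (n 0)) ≠ 0 ∨ qpolar (polarForm F (n 0)) (n 2) (n 3) ≠ 0 ∨
      eval (n 3) (polarForm F (n 0)) ≠ 0
  · exact isLineSweptPoint_of_mem_tangentCubicSection_of_frame X i h2 hc hF hrange L hLhom hLli n hn hLM hl₀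
      hu hv hA hFM hη2 hLη hnolin
  by_cases hB : eval (n 2) (polarForm F (n 1)) ≠ 0 ∨ qpolar (polarForm F (n 1)) (n 2) (n 3) ≠ 0 ∨
      eval (n 3) (polarForm F (n 1)) ≠ 0
  · -- swap the roles of `a` and `b`
    let σ : Equiv.Perm (Fin 4) := Equiv.swap 0 1
    have hσ0 : σ 0 = 1 := Equiv.swap_apply_left 0 1
    have hσ1 : σ 1 = 0 := Equiv.swap_apply_right 0 1
    have hσ2 : σ 2 = 2 := Equiv.swap_apply_of_ne_of_ne (by decide) (by decide)
    have hσ3 : σ 3 = 3 := Equiv.swap_apply_of_ne_of_ne (by decide) (by decide)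
    have hrange' : Set.range (n ∘ σ) = Set.range n := σ.surjective.range_comp n
    have hn' : LinearIndependent k (n ∘ σ) := hn.comp σ σ.injective
    have hswap : ∀ {G : MvPolynomial (Fin (d + 1 + 1)) k}, (∀ s t : k, eval (s • n 0 + t • n 1) G = 0) →
        ∀ s t : k, eval (s • (n ∘ σ) 0 + t • (n ∘ σ) 1) G = 0 := by
      intro G hG s t
      change eval (s • n (σ 0) + t • n (σ 1)) G = 0
      rw [hσ0, hσ1, add_comm (s • n 1)]
      exact hG t s
    refine isLineSweptPoint_of_mem_tangentCubicSection_of_frame X i h2 hc hF hrange L hLhom hLli (n ∘ σ) hn'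
      (by rw [hrange']; exact hLM) (hswap hl₀) ?_ ?_ ?_ (by rw [hrange']; exact hFM) hη2 hLη
      (by rw [hrange']; exact hnolin)
    · change ∀ s t : k, eval (s • (n ∘ σ) 0 + t • (n ∘ σ) 1) (polarForm F (n (σ 2))) = 0
      rw [hσ2]; exact hswap hu
    · change ∀ s t : k, eval (s • (n ∘ σ) 0 + t • (n ∘ σ) 1) (polarForm F (n (σ 3))) = 0
      rw [hσ3]; exact hswap hv
    · change eval (n (σ 2)) (polarForm F (n (σ 0))) ≠ 0 ∨ qpolar (polarForm F (n (σ 0))) (n (σ 2)) (n (σ 3)) ≠ 0 ∨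
        eval (n (σ 3)) (polarForm F (n (σ 0))) ≠ 0
      rw [hσ0, hσ2, hσ3]
      exact hB
  -- DEGENERATE CASE: `F` restricted to `M̂` is the binary cubic `F(γ₁ u + γ₂ v)` — three planes through `l₀`
  exfalso
  push Not at hA hB
  obtain ⟨hAu, hAq, hAv⟩ := hA
  obtain ⟨hBu, hBq, hBv⟩ := hB
  have hGa : (polarForm F (n 0)).IsHomogeneous 2 := isHomogeneous_polarForm hF (n 0)
  have hGb : (polarForm F (n 1)).IsHomogeneous 2 := isHomogeneous_polarForm hF (n 1)
  have hGaw : ∀ γ₁ γ₂ : k, eval (γ₁ • n 2 + γ₂ • n 3) (polarForm F (n 0)) = 0 := by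
    intro γ₁ γ₂
    rw [eval_add_smul_smul_eq hGa h2, hAu, hAq, hAv, mul_zero, mul_zero, mul_zero, add_zero, add_zero]
  have hGbw : ∀ γ₁ γ₂ : k, eval (γ₁ • n 2 + γ₂ • n 3) (polarForm F (n 1)) = 0 := by
    intro γ₁ γ₂
    rw [eval_add_smul_smul_eq hGb h2, hBu, hBq, hBv, mul_zero, mul_zero, mul_zero, add_zero, add_zero]
  have hFval : ∀ cf : Fin 4 → k, eval (∑ c', cf c' • n c') F =
      cf 2 ^ 3 * eval (n 2) F + cf 2 ^ 2 * cf 3 * dirD F (n 2) (n 3) + cf 2 * cf 3 ^ 2 * dirD F (n 3) (n 2) +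
        cf 3 ^ 3 * eval (n 3) F := by
    intro cf
    rw [Fin.sum_univ_four, show cf 0 • n 0 + cf 1 • n 1 + cf 2 • n 2 + cf 3 • n 3 =
      (cf 0 • n 0 + cf 1 • n 1) + (cf 2 • n 2 + cf 3 • n 3) by abel,
      eval_add_eq_of_tangent hF hl₀ hu hv, dirD_add_smul_smul, ← eval_polarForm, ← eval_polarForm, hGaw, hGbw,
      mul_zero, mul_zero, add_zero, zero_add, eval_smul_add_smul_cubic hF h2]
  -- linear factors of the binary cubic
  obtain ⟨r₁, r₂, e₀, e₁, e₂, hr, hfac⟩ := exists_linear_factor_cubic (eval (n 2) F) (dirD F (n 2) (n 3))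
    (dirD F (n 3) (n 2)) (eval (n 3) F)
  obtain ⟨r₁', r₂', f₁, f₂, hr', hfac'⟩ := exists_linear_factor_quadratic e₀ e₁ e₂
  -- normalised dual forms `λ_u(P) = γ₁`, `λ_v(P) = γ₂` on `M̂`
  have h013 : LinearIndependent k ![n 0, n 1, n 3] := by
    have h := hn.comp ![(0 : Fin 4), 1, 3] (by decide)
    convert h using 1
    funext a; fin_cases a <;> rfl
  have h2' : n 2 ∉ Submodule.span k (Set.range ![n 0, n 1, n 3]) := by
    rw [range_vec3_eq_image]; exact hn.notMem_span_image (s := {0, 1, 3}) (x := 2) (by decide)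
  obtain ⟨lam₂, hlam₂hom, hlam₂van, hlam₂y⟩ := exists_linearForm_vanishing_eval_ne_zero h013 h2'
  have h012 : LinearIndependent k ![n 0, n 1, n 2] := by
    have h := hn.comp ![(0 : Fin 4), 1, 2] (by decide)
    convert h using 1
    funext a; fin_cases a <;> rfl
  have h3' : n 3 ∉ Submodule.span k (Set.range ![n 0, n 1, n 2]) := by
    rw [range_vec3_eq_image]; exact hn.notMem_span_image (s := {0, 1, 2}) (x := 3) (by decide)
  obtain ⟨lam₃, hlam₃hom, hlam₃van, hlam₃w⟩ := exists_linearForm_vanishing_eval_ne_zero h012 h3'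
  obtain ⟨φ₂, hφ₂⟩ := exists_linearMap_forall_eval_eq hlam₂hom
  obtain ⟨φ₃, hφ₃⟩ := exists_linearMap_forall_eval_eq hlam₃hom
  have v20 : φ₂ (n 0) = 0 := by rw [← hφ₂]; exact hlam₂van _ (Submodule.subset_span ⟨0, rfl⟩)
  have v21 : φ₂ (n 1) = 0 := by rw [← hφ₂]; exact hlam₂van _ (Submodule.subset_span ⟨1, rfl⟩)
  have v23 : φ₂ (n 3) = 0 := by rw [← hφ₂]; exact hlam₂van _ (Submodule.subset_span ⟨2, rfl⟩)
  have v30 : φ₃ (n 0) = 0 := by rw [← hφ₃]; exact hlam₃van _ (Submodule.subset_span ⟨0, rfl⟩)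
  have v31 : φ₃ (n 1) = 0 := by rw [← hφ₃]; exact hlam₃van _ (Submodule.subset_span ⟨1, rfl⟩)
  have v32 : φ₃ (n 2) = 0 := by rw [← hφ₃]; exact hlam₃van _ (Submodule.subset_span ⟨2, rfl⟩)
  set c₂ := eval (n 2) lam₂ with hc₂
  set c₃ := eval (n 3) lam₃ with hc₃
  let lamU : MvPolynomial (Fin (d + 1 + 1)) k := MvPolynomial.C c₂⁻¹ * lam₂
  let lamV : MvPolynomial (Fin (d + 1 + 1)) k := MvPolynomial.C c₃⁻¹ * lam₃
  have hlamUhom : lamU.IsHomogeneous 1 := hlam₂hom.C_mul _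
  have hlamVhom : lamV.IsHomogeneous 1 := hlam₃hom.C_mul _
  have hUval : ∀ cf : Fin 4 → k, eval (∑ c', cf c' • n c') lamU = cf 2 := by
    intro cf
    have hy2 : φ₂ (n 2) = c₂ := by rw [← hφ₂]
    simp only [lamU, map_mul, MvPolynomial.eval_C, hφ₂, Fin.sum_univ_four, map_add, map_smul, v20, v21, v23, hy2,
      smul_eq_mul]
    field_simp
    ring
  have hVval : ∀ cf : Fin 4 → k, eval (∑ c', cf c' • n c') lamV = cf 3 := by
    intro cf
    have hw3 : φ₃ (n 3) = c₃ := by rw [← hφ₃]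
    simp only [lamV, map_mul, MvPolynomial.eval_C, hφ₃, Fin.sum_univ_four, map_add, map_smul, v30, v31, v32, hw3,
      smul_eq_mul]
    field_simp
    ring
  -- the three linear forms
  let l1 : MvPolynomial (Fin (d + 1 + 1)) k := MvPolynomial.C r₂ * lamU - MvPolynomial.C r₁ * lamV
  let l2 : MvPolynomial (Fin (d + 1 + 1)) k := MvPolynomial.C r₂' * lamU - MvPolynomial.C r₁' * lamV
  let l3 : MvPolynomial (Fin (d + 1 + 1)) k := MvPolynomial.C f₁ * lamU + MvPolynomial.C f₂ * lamV
  have hl1hom : l1.IsHomogeneous 1 := (hlamUhom.C_mul _).sub (hlamVhom.C_mul _)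
  have hl2hom : l2.IsHomogeneous 1 := (hlamUhom.C_mul _).sub (hlamVhom.C_mul _)
  have hl3hom : l3.IsHomogeneous 1 := (hlamUhom.C_mul _).add (hlamVhom.C_mul _)
  have hl1val : ∀ cf : Fin 4 → k, eval (∑ c', cf c' • n c') l1 = r₂ * cf 2 - r₁ * cf 3 := fun cf => by
    simp only [l1, map_sub, map_mul, MvPolynomial.eval_C, hUval, hVval]
  have hl2val : ∀ cf : Fin 4 → k, eval (∑ c', cf c' • n c') l2 = r₂' * cf 2 - r₁' * cf 3 := fun cf => by
    simp only [l2, map_sub, map_mul, MvPolynomial.eval_C, hUval, hVval]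
  have hl3val : ∀ cf : Fin 4 → k, eval (∑ c', cf c' • n c') l3 = f₁ * cf 2 + f₂ * cf 3 := fun cf => by
    simp only [l3, map_add, map_mul, MvPolynomial.eval_C, hUval, hVval]
  -- `F ≡ l1 l2 l3 mod (L)`
  have hFfac : ∀ P ∈ M, eval P F = eval P l1 * (eval P l2 * eval P l3) := by
    intro P hP
    obtain ⟨cf, rfl⟩ := (Submodule.mem_span_range_iff_exists_fun k).1 hP
    rw [hFval, hl1val, hl2val, hl3val]
    have h := hfac (cf 2) (cf 3)
    have h' := hfac' (cf 2) (cf 3)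
    rw [h']  at h
    linear_combination h
  have hdiff : F - l1 * (l2 * l3) ∈ Ideal.span (Set.range L) := by
    refine mem_idealSpan_of_forall_mem_span_eval_eq_zero hn hLli hLhom hMvan (by omega) fun P hP => ?_
    rw [map_sub, map_mul, map_mul, hFfac P hP, sub_self]
  have hFη : F ∈ ProjectiveSpectrum.asHomogeneousIdeal
      (𝒜 := homogeneousSubmodule (Fin (d + 1 + 1)) k) (i.left.base η) := by
    have hmem : i.left.base η ∈ Set.range i.left.base := ⟨η, rfl⟩
    rw [hrange] at hmem
    exact hmem (Set.mem_singleton F)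
  have hprime := (i.left.base η).isPrime
  have hprod : l1 * (l2 * l3) ∈ (ProjectiveSpectrum.asHomogeneousIdeal
      (𝒜 := homogeneousSubmodule (Fin (d + 1 + 1)) k) (i.left.base η)).toIdeal := by
    have hLle : Ideal.span (Set.range L) ≤ (ProjectiveSpectrum.asHomogeneousIdeal
        (𝒜 := homogeneousSubmodule (Fin (d + 1 + 1)) k) (i.left.base η)).toIdeal := by
      rw [Ideal.span_le]; rintro _ ⟨j, rfl⟩; exact hLη j
    have h1 : F - (F - l1 * (l2 * l3)) = l1 * (l2 * l3) := by ring
    rw [← h1]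
    exact Ideal.sub_mem _ hFη (hLle hdiff)
  -- the values of the linear forms at `u = Σ e₂ • n` and `v = Σ e₃ • n`
  have hs2 : ∑ c', (Pi.single 2 1 : Fin 4 → k) c' • n c' = n 2 := by rw [Fin.sum_univ_four]; simp
  have hs3 : ∑ c', (Pi.single 3 1 : Fin 4 → k) c' • n c' = n 3 := by rw [Fin.sum_univ_four]; simp
  have hzeroUV : ∀ {l : MvPolynomial (Fin (d + 1 + 1)) k} {p q : k},
      (∀ cf : Fin 4 → k, eval (∑ c', cf c' • n c') l = p * cf 2 + q * cf 3) → (∀ v ∈ M, eval v l = 0) →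
        p = 0 ∧ q = 0 := by
    intro l p q hval hzero
    constructor
    · have h := hzero _ (hnmem 2)
      rw [← hs2, hval] at h
      simpa using h
    · have h := hzero _ (hnmem 3)
      rw [← hs3, hval] at h
      simpa using h
  rcases hprime.mem_or_mem hprod with h1 | h23
  · have hz := hnolin l1 hl1hom h1
    obtain ⟨hp, hq⟩ := hzeroUV (l := l1) (p := r₂) (q := -r₁) (fun cf => by rw [hl1val]; ring) hz
    rcases hr with h | h
    · exact h (neg_eq_zero.1 hq)
    · exact h hp
  rcases hprime.mem_or_mem h23 with h2l | h3l
  · have hz := hnolin l2 hl2hom h2l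
    obtain ⟨hp, hq⟩ := hzeroUV (l := l2) (p := r₂') (q := -r₁') (fun cf => by rw [hl2val]; ring) hz
    rcases hr' with h | h
    · exact h (neg_eq_zero.1 hq)
    · exact h hp
  · have hz := hnolin l3 hl3hom h3l
    obtain ⟨w, hwM, hw⟩ := hFM
    exact hw (by rw [hFfac w hwM, hz w hwM, mul_zero, mul_zero])

end Main

end ProjFamily

end Literature.AlgebraicGeometry.Motives
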